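import Mathlib
import Literature.AlgebraicGeometry.Resolution.CurveCentreNearPointGammaPrimeRegular
import HarnessLib

/-!
# Route `RadicialJung`, crux `CleanModels` (stmt-ResolutionOfSingularities-15917), line `Sketch` rev 35, stub 6 `stub_cleanProp44` (X44c):
# `Γ′ → Y` UNRAMIFIED, WITH THE EXCEPTIONAL PARAMETER — the export needed by the adapted triple at a point of `Γ′` (census item (v))

Seat decomp-res-hand-2 g20 (structural hand); sequel of ✓ `…CleanProp44GammaPrimeUnramified.lean` and ✓ `…CleanProp44GammaPrimeTransversal.lean`.
To read hand-2 g19's ✓ `cleanPermissibleAt_exceptionalCurve_or_obstruction_of_sides_general` at a closed point `z` of the horizontal successor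
`Γ′ = cl{η′}` of a curve centre `Y` FOR THE CURVE `Γ′` one needs `he'` (`(e′) = 𝓘_{Y,x} 𝒪_{X′,z}`) and `hzz` (`(e′, z_Γ, z′) = 𝔪_z`) with
`(e′, z_Γ) = 𝔭_{η′}`.  `IsBlowup.exists_isRsopPart_unramified_exceptional_of_isNear_curve` re-runs the tree proof of [CoP1] Lemma 4.3 (4)
(«`x′ := (y₁′ = y₁, y₂′ = y₂/y₁, y₃)`», ✓ `IsBlowup.exists_isRsopPart_le_primeOfSpecializes_of_isNear_curve`) exporting, besides unramifiedness, that the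
first member `π♯c_j` of the pair generates the exceptional ideal; the companion ✓ `…CleanProp44GammaPrimeAdapted.lean` packages THE ADAPTED TRIPLE: for every
parameter `w ∈ 𝔪_x` along `Y` (`𝔪_x ⊆ 𝓘_{Y,x} + (w)`) and `𝔭_{η′} ≠ 𝔪_z`: `(e′) = 𝓘_{Y,x} 𝒪_{X′,z}`, `(e′, z_Γ) = 𝔭_{η′}`, `(e′, z_Γ, π♯w) = 𝔪_z`,
`π♯w ∉ 𝔭_{η′} + 𝔪_z²`, `π♯w ∉ 𝔭_{η′}` — so in `…_of_sides_general` for `N = 𝔭_{η′}` the `w`-side is at most a side of a CORNER.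
Honest framing: OURS (re-export + packaging of tree results); nothing here proves X44c, any case of `CleanModels`, or resolution of singularities in
characteristic `p`. [cite: CossartPiltant2008, Lemma 4.3 (4); proof of Prop. 4.4, p. 10 L11–12] [cite: Matsumura1987, Thm. 14.2]
-/

noncomputable section

set_option linter.dupNamespace false -- mandated namespace of this single-conjunct summit

open CategoryTheory AlgebraicGeometry TopologicalSpace IsLocalRing
open Literature.AlgebraicGeometry.Resolution
open Scheme.IdealSheafData

namespace Summit.ResolutionOfSingularities.ResolutionOfSingularities.Theorems.RadicialJung.CleanModels

universe u

variable {X X' : Scheme.{u}} {π : X' ⟶ X}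

set_option maxHeartbeats 800000 in
-- one long chart computation over the Rees chart ring of a stalk (verbatim re-run of the tree proof with a richer export)
/-- **`Γ′ → Y` is unramified, with the pair `(π♯c_j, t − π♯a)` inside `𝔭_{η′}` and `(π♯c_j) = 𝓘_{Y,x} 𝒪_{X′,z}`.**  For the blowing up `π` of the regular locally Noetherian `X`
along the regular irreducible codimension-`2` centre `Y ⊆ {ord J = μ}` (`μ ≥ 1`) and a near point `η′` over the generic point of `Y`, at every
`z` with `η′ ⤳ z`: there is a pair `v`, part of a regular system of parameters of `𝒪_{X′,z}`, with `(v) ⊆ 𝔭_{η′}`; moreover `𝓘_{Y,π z} 𝒪_{X′,z} ⊆ 𝔭_{η′}`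
and `𝔪_z ⊆ 𝔭_{η′} + 𝔪_{π z} 𝒪_{X′,z}` (the regular system is `(π♯c_j, t − π♯a, π♯w)` with `w` completing the adapted pair `c` at `π z`).
[cite: CossartPiltant2008, Lemma 4.3 (4) (proof of Prop. 4.4, p. 10 L11–12)] -/
theorem _root_.Literature.AlgebraicGeometry.Resolution.IsBlowup.exists_isRsopPart_unramified_exceptional_of_isNear_curve
    [IsLocallyNoetherian X] [IsLocallyNoetherian X'] (hX : Scheme.IsRegular X) {Y : Closeds X}
    (hreg : Scheme.IsRegular (vanishingIdeal Y).subscheme) (hπ : IsBlowup π (vanishingIdeal Y))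
    {J : X.IdealSheafData} {μ : ℕ} (hμ : 1 ≤ μ) (hY : ∀ y ∈ (Y : Set X), idealOrder J y = μ)
    {η' : X'} (hη' : closure {π η'} = (Y : Set X)) (hcodim : Order.coheight (π η') = 2)
    (hnear : IsNear π (vanishingIdeal Y) J μ η') {z : X'} (hz : η' ⤳ z) :
    ∃ v : Fin 2 → X'.presheaf.stalk z, IsRsopPart v ∧
      Ideal.span (Set.range v) ≤ primeOfSpecializes hz ∧
      (stalkIdeal (vanishingIdeal Y) (π z)).map (π.stalkMap z).hom ≤ primeOfSpecializes hz ∧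
      maximalIdeal (X'.presheaf.stalk z) ≤
        primeOfSpecializes hz ⊔ (maximalIdeal (X.presheaf.stalk (π z))).map (π.stalkMap z).hom ∧
      Ideal.span {v 0} = (stalkIdeal (vanishingIdeal Y) (π z)).map (π.stalkMap z).hom := by
  classical
  have hx : π η' ⤳ π z := hz.map π.continuous
  haveI hRx : IsRegularLocalRing (X.presheaf.stalk (π z)) := hX _
  haveI hRη : IsRegularLocalRing (X.presheaf.stalk (π η')) := hX _
  have hX' : Scheme.IsRegular X' := hπ.isRegular_of_isRegular_subscheme hX hreg
  haveI : IsRegularLocalRing (X'.presheaf.stalk z) := hX' z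
  haveI : IsRegularLocalRing (X'.presheaf.stalk η') := hX' η'
  have hYc : Y = ⟨closure {π η'}, isClosed_closure⟩ := Closeds.ext hη'.symm
  have hη'Y : π η' ∈ (Y : Set X) := hη' ▸ subset_closure rfl
  have hxY : π z ∈ (Y : Set X) := hx.mem_closed Y.isClosed hη'Y
  have hxC : π z ∈ (vanishingIdeal Y).support := by rw [← SetLike.mem_coe, coe_support_vanishingIdeal]; exact hxY
  have hP𝔭 : stalkIdeal (vanishingIdeal Y) (π z) = primeOfSpecializes hx := hYc ▸ stalkIdeal_vanishingIdeal_closure hx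
  obtain ⟨r, c, hcr, hcY⟩ := exists_isRsopPart_span_range_eq_stalkIdeal_of_mem_closeds hreg hxY
  obtain rfl : r = 2 := by
    have h1 := hcr.height_span_range
    rw [hcY, hP𝔭] at h1
    have h2 := coe_height_primeOfSpecializes hx
    rw [h1, hcodim] at h2
    exact_mod_cast h2
  have hnz : IsNear π (vanishingIdeal Y) J μ z :=
    hπ.isNear_of_specializes_of_isNear_curve hX hreg hY hη'Y hz hnear
  have hcm : ∀ i, c i ∈ maximalIdeal _ := hcr.mem_maximalIdeal
  have hcq : IsQuasiRegular c := by
    obtain ⟨e, zz, hd, hzz, hzzc⟩ := hcr.exists_rsop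
    have h := isQuasiRegular_rsop_comp hd zz hzz (Fin.castAdd e) (Fin.castAdd_injective 2 e)
    rwa [show zz ∘ Fin.castAdd e = c from funext hzzc] at h
  obtain ⟨j, 𝔴₀, χ₀, hχ₀, hloc₀, h𝔴₀⟩ := hπ.exists_reesChart_stalk z c hcY
  have h𝔴₀' : (maximalIdeal _).map (chartBase c j) ≤ 𝔴₀.asIdeal := by rw [← h𝔴₀]; exact Ideal.map_comap_le
  obtain ⟨l, hl⟩ : ∃ l : Fin 2, l ≠ j := ⟨j + 1, by fin_cases j <;> decide⟩
  have hnearF : ∀ F : MvPolynomial (Fin 2) (X.presheaf.stalk (π z)), F.IsHomogeneous μ →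
      MvPolynomial.eval c F ∈ stalkIdeal J (π z) →
      (algebraMap (chartRing c j) (Localization.AtPrime 𝔴₀.asIdeal) :
          chartRing c j →+* Localization.AtPrime 𝔴₀.asIdeal)
          (MvPolynomial.eval₂Hom (chartBase c j) (fun i => chartGen c j i) F) ∈
        maximalIdeal (Localization.AtPrime 𝔴₀.asIdeal) ^ μ :=
    fun F hF hFJ => algebraMap_eval₂Hom_mem_pow_of_isNear hcY j 𝔴₀ χ₀ hχ₀ hloc₀ hnz hF hFJ
  obtain ⟨a₀, ha₀⟩ :=
    exists_forall_mem_initialForms_eq_C_mul_pow c j hl hcq hcm 𝔴₀.asIdeal h𝔴₀' hμ hnearF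
  obtain ⟨ã₀, hã₀⟩ := residue_surjective (R := X.presheaf.stalk (π z)) a₀
  have ha₀' : ∀ G ∈ initialForms c (stalkIdeal J (π z)) μ, ∃ c₀ : ResidueField _,
      G = MvPolynomial.C c₀ * (MvPolynomial.X l -
        MvPolynomial.C (residue _ ã₀) * MvPolynomial.X j) ^ μ := by
    rw [hã₀]; exact ha₀
  have hadapt := initialForms_shiftRsop_adapted c j hl ã₀ ha₀'
  obtain ⟨c₂, hc₂⟩ : ∃ c₂ : Fin 2 → X.presheaf.stalk (π z), c₂ = shiftRsop c j fun _ => ã₀ := ⟨_, rfl⟩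
  have hcr₂ : IsRsopPart c₂ := hc₂ ▸ hcr.shiftRsop j ã₀
  have hcY₂ : Ideal.span (Set.range c₂) = stalkIdeal (vanishingIdeal Y) (π z) := by
    rw [hc₂, span_range_shiftRsop, hcY]
  replace hadapt : ∀ G ∈ initialForms c₂ (stalkIdeal J (π z)) μ,
      ∃ c₀ : ResidueField (X.presheaf.stalk (π z)), G = MvPolynomial.C c₀ * MvPolynomial.X l ^ μ := by
    rw [hc₂]; exact hadapt
  have hcm₂ : ∀ i, c₂ i ∈ maximalIdeal _ := hcr₂.mem_maximalIdeal
  obtain ⟨e, zz, hd, hzz, hzzc⟩ := hcr₂.exists_rsop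
  obtain ⟨w, hw⟩ : ∃ w : Fin e → X.presheaf.stalk (π z), w = fun k => zz (Fin.natAdd 2 k) := ⟨_, rfl⟩
  have happ : Fin.append c₂ w = zz := by
    funext i
    induction i using Fin.addCases with
    | left i => rw [Fin.append_left, hzzc]
    | right k => rw [Fin.append_right, hw]
  have hzspan : Ideal.span (Set.range (Fin.append c₂ w)) = maximalIdeal _ := by rw [happ]; exact hzz
  obtain ⟨𝔴, χ, hχ, hloc, h𝔴, he, -, hdim', hspan', hmul⟩ :=
    hπ.exists_chart_rsop_of_isNear_curve_of_adapted hX hreg hμ hY hcr₂ hcY₂ j hl hadapt hnz w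
      hzspan hd
  obtain ⟨t, ht⟩ : ∃ t : X'.presheaf.stalk z, t = χ (chartGen c₂ j l) := ⟨_, rfl⟩
  rw [← ht] at hmul
  have hJP : stalkIdeal J (π z) ≤ Ideal.span (Set.range c₂) ^ μ := by
    rw [hcY₂, ← stalkIdeal_pow]
    exact stalkIdeal_mono (le_vanishingIdeal_pow_of_forall_idealOrder_eq hX hreg hY) _
  have hJnot : ¬ stalkIdeal J (π z) ≤ maximalIdeal _ ^ (μ + 1) := by
    rw [← le_idealOrder_iff, hY (π z) hxY]
    exact_mod_cast Nat.not_succ_le_self μ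
  obtain ⟨f, hfJ, hf'⟩ := Set.not_subset.mp hJnot
  obtain ⟨F, hF, hFf⟩ := exists_isHomogeneous_of_mem_span_pow c₂ μ (hJP hfJ)
  have hF0 : MvPolynomial.map (residue _) F ≠ 0 :=
    map_residue_ne_zero_of_eval_not_mem_pow_succ c₂ hcm₂ hF (by rw [hFf]; exact hf')
  have hFJ : MvPolynomial.eval c₂ F ∈ stalkIdeal J (π z) := by rw [hFf]; exact hfJ
  have hGmem : MvPolynomial.map (residue _) F ∈ initialForms c₂ (stalkIdeal J (π z)) μ :=
    (mem_initialForms_iff c₂).mpr ⟨F, hF, hFJ, rfl⟩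
  obtain ⟨c₀, hc₀⟩ := hadapt _ hGmem
  have hunit : IsUnit (F.coeff (Finsupp.single l μ)) := by
    have hc₀ne : c₀ ≠ 0 := by
      rintro rfl; apply hF0; rw [hc₀, MvPolynomial.C_0, zero_mul]
    have hcoef : residue _ (F.coeff (Finsupp.single l μ)) = c₀ := by
      have h := congrArg (MvPolynomial.coeff (Finsupp.single l μ)) hc₀
      rw [MvPolynomial.coeff_map, MvPolynomial.X_pow_eq_monomial, MvPolynomial.C_mul_monomial, mul_one,
        MvPolynomial.coeff_monomial, if_pos rfl] at h
      exact h
    by_contra hnu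
    apply hc₀ne
    rw [← hcoef, IsLocalRing.residue_eq_zero_iff]
    exact (IsLocalRing.mem_maximalIdeal _).mpr hnu
  have hff' := reesChartBase_eval_eq_pow_mul_eval₂ c₂ j hF
  have hu : ∀ i, (π.stalkMap z).hom (c₂ i) = (π.stalkMap z).hom (c₂ j) * χ (chartGen c₂ j i) :=
    fun i => by rw [← hχ, ← hχ, ← map_mul, ← reesChartBase_apply_eq_mul_chartGen c₂ j i]
  have hCmap : (stalkIdeal (vanishingIdeal Y) (π z)).map (π.stalkMap z).hom =
      Ideal.span {χ (chartBase c₂ j (c₂ j))} := by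
    rw [← hcY₂, Ideal.map_span_range_eq_span_singleton _ c₂ j _ hu, ← hχ]
  have hmem : χ (MvPolynomial.eval₂Hom (chartBase c₂ j) (fun i => chartGen c₂ j i) F) ∈
      stalkIdeal (controlledTransform π (vanishingIdeal Y) J μ) z := by
    rw [controlledTransform, stalkIdeal_colon, stalkIdeal_pow, stalkIdeal_comap_eq_map_stalkMap,
      stalkIdeal_comap_eq_map_stalkMap, hCmap]
    exact map_mem_colon_of_eq_pow_mul (chartBase c₂ j) χ (π.stalkMap z).hom hχ hff' hFJ
  have hgP : χ (MvPolynomial.eval₂Hom (chartBase c₂ j) (fun i => chartGen c₂ j i) F) ∈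
      primeOfSpecializes hz := by
    have h1 : (X'.presheaf.stalkSpecializes hz).hom
        (χ (MvPolynomial.eval₂Hom (chartBase c₂ j) (fun i => chartGen c₂ j i) F)) ∈
        stalkIdeal (controlledTransform π (vanishingIdeal Y) J μ) η' := by
      rw [← stalkIdeal_map_stalkSpecializes _ hz]
      exact Ideal.mem_map_of_mem _ hmem
    have h2 : stalkIdeal (controlledTransform π (vanishingIdeal Y) J μ) η' ≤ maximalIdeal _ :=
      ((le_idealOrder_iff _ η' μ).mp (isNear_iff.mp hnear).ge).trans (Ideal.pow_le_self (by omega))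
    exact Ideal.mem_comap.mpr (h2 h1)
  obtain ⟨ψK, hψKdef⟩ : ∃ ψK : X'.presheaf.stalk z →+* ResidueField (X'.presheaf.stalk η'),
      ψK = (residue _).comp (X'.presheaf.stalkSpecializes hz).hom := ⟨_, rfl⟩
  have hψK : ∀ r, ψK r = 0 ↔ r ∈ primeOfSpecializes hz := fun r => by
    rw [hψKdef, RingHom.comp_apply, IsLocalRing.residue_eq_zero_iff, Ideal.mem_comap]
  have hφP : ∀ a, (π.stalkMap z).hom a ∈ primeOfSpecializes hz ↔ a ∈ primeOfSpecializes hx :=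
    fun a => by rw [← Ideal.mem_comap, comap_stalkMap_primeOfSpecializes π hz]
  haveI hp𝔭 : (primeOfSpecializes hx).IsPrime := Ideal.IsPrime.comap _
  haveI hSreg : IsRegularLocalRing (X.presheaf.stalk (π z) ⧸ primeOfSpecializes hx) := by
    have h := isRegularLocalRing_stalk_quotient_stalkIdeal hreg hxC
    rwa [hP𝔭] at h
  haveI : IsDomain (X.presheaf.stalk (π z) ⧸ primeOfSpecializes hx) := isDomain_of_isRegularLocalRing _
  haveI : IsIntegrallyClosed (X.presheaf.stalk (π z) ⧸ primeOfSpecializes hx) :=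
    isIntegrallyClosed_of_isRegularLocalRing _
  let σ : (X.presheaf.stalk (π z) ⧸ primeOfSpecializes hx) →+* ResidueField (X'.presheaf.stalk η') :=
    Ideal.Quotient.lift (primeOfSpecializes hx) (ψK.comp (π.stalkMap z).hom)
      (fun a ha => (hψK _).mpr ((hφP a).mpr ha))
  letI := σ.toAlgebra
  have hσq : ∀ a, algebraMap (X.presheaf.stalk (π z) ⧸ primeOfSpecializes hx)
      (ResidueField (X'.presheaf.stalk η')) (Ideal.Quotient.mk _ a) = ψK ((π.stalkMap z).hom a) :=
    fun a => Ideal.Quotient.lift_mk _ _ _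
  haveI : FaithfulSMul (X.presheaf.stalk (π z) ⧸ primeOfSpecializes hx)
      (ResidueField (X'.presheaf.stalk η')) := by
    rw [faithfulSMul_iff_algebraMap_injective, injective_iff_map_eq_zero]
    intro q hq
    obtain ⟨a, rfl⟩ := Ideal.Quotient.mk_surjective q
    rw [hσq, hψK, hφP] at hq
    exact Ideal.Quotient.eq_zero_iff_mem.mpr hq
  haveI : Unique {i : Fin 2 // i ≠ j} := (finSuccAboveEquiv j).symm.unique
  have hroot : MvPolynomial.eval₂ (ψK.comp (π.stalkMap z).hom) (fun _ => ψK t) (dehomogenize j F) = 0 := by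
    have h0 : ψK (χ (MvPolynomial.eval₂Hom (chartBase c₂ j) (fun i => chartGen c₂ j i) F)) = 0 :=
      (hψK _).mpr hgP
    have hk := RingHom.congr_fun (eval₂Hom_comp_aeval_kill c₂ j) F
    have hdh : (MvPolynomial.aeval (fun j_1 : Fin 2 => if h : j_1 = j then
        (1 : MvPolynomial {i : Fin 2 // i ≠ j} (X.presheaf.stalk (π z))) else MvPolynomial.X ⟨j_1, h⟩)).toRingHom F =
        dehomogenize j F := rfl
    rw [RingHom.comp_apply, hdh] at hk
    rw [← hk, MvPolynomial.map_eval₂Hom, MvPolynomial.map_eval₂Hom] at h0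
    have hring : ψK.comp (χ.comp (chartBase c₂ j)) = ψK.comp (π.stalkMap z).hom := by
      ext a
      simp only [RingHom.comp_apply, hχ]
    have hfun : (fun i : {i : Fin 2 // i ≠ j} => ψK (χ (chartGen c₂ j i.1))) = fun _ => ψK t := by
      funext i
      have hi : i = ⟨l, hl⟩ := Subsingleton.elim _ _
      rw [hi, ht]
    rw [hring, hfun, MvPolynomial.coe_eval₂Hom] at h0
    exact h0
  have hint : IsIntegral (X.presheaf.stalk (π z) ⧸ primeOfSpecializes hx) (ψK t) :=
    isIntegral_of_eval₂_dehomogenize_eq_zero (ψK.comp (π.stalkMap z).hom) (Ideal.Quotient.mk _)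
      (fun r => hσq r) hF hl hroot (hunit.map _)
  obtain ⟨cη, hcηr, hcηY⟩ := exists_isRsopPart_fin_two_of_closure_eq hreg hη'.symm hcodim
  have hsurj := hπ.residue_comp_stalkMap_surjective_of_isNear hX hreg hμ hY hcηr hcηY hnear
  obtain ⟨ρ, hρ⟩ := hsurj (ψK t)
  letI algx := (X.presheaf.stalkSpecializes hx).hom.toAlgebra
  haveI hlocx : IsLocalization.AtPrime (X.presheaf.stalk (π η')) (primeOfSpecializes hx) :=
    isLocalizationAtPrime_stalkSpecializes hx
  obtain ⟨⟨b, sden⟩, hbs⟩ := IsLocalization.surj (primeOfSpecializes hx).primeCompl ρ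
  have hnat : ∀ a : X.presheaf.stalk (π z),
      (π.stalkMap η').hom ((X.presheaf.stalkSpecializes hx).hom a) =
        (X'.presheaf.stalkSpecializes hz).hom ((π.stalkMap z).hom a) :=
    fun a => Scheme.Hom.stalkSpecializes_stalkMap_apply π η' z hz a
  have hκ : ∀ a : X.presheaf.stalk (π z),
      residue _ ((π.stalkMap η').hom (algebraMap (X.presheaf.stalk (π z)) (X.presheaf.stalk (π η')) a)) =
        ψK ((π.stalkMap z).hom a) := by
    intro a
    rw [RingHom.algebraMap_toAlgebra, hnat, hψKdef, RingHom.comp_apply]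
  have key : algebraMap (X.presheaf.stalk (π z) ⧸ primeOfSpecializes hx) (ResidueField (X'.presheaf.stalk η'))
        (Ideal.Quotient.mk _ (sden : X.presheaf.stalk (π z))) * ψK t =
      algebraMap (X.presheaf.stalk (π z) ⧸ primeOfSpecializes hx) (ResidueField (X'.presheaf.stalk η'))
        (Ideal.Quotient.mk _ b) := by
    have h := congrArg ((residue _).comp (π.stalkMap η').hom) hbs
    simp only [RingHom.comp_apply, map_mul] at h
    rw [hσq, hσq, ← hκ, ← hκ, ← h, ← RingHom.comp_apply (residue _) (π.stalkMap η').hom ρ, hρ, mul_comm]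
  have hs0 : (Ideal.Quotient.mk (primeOfSpecializes hx) (sden : X.presheaf.stalk (π z))) ≠ 0 := by
    rw [Ne, Ideal.Quotient.eq_zero_iff_mem]; exact sden.2
  obtain ⟨ā, hā⟩ := exists_algebraMap_eq_of_isIntegral_of_mul_eq hint hs0 key
  obtain ⟨a, rfl⟩ := Ideal.Quotient.mk_surjective ā
  rw [hσq] at hā
  have htP : t - (π.stalkMap z).hom a ∈ primeOfSpecializes hz := by
    rw [← hψK, map_sub, hā, sub_self]
  have hPle : primeOfSpecializes hz ≤ maximalIdeal (X'.presheaf.stalk z) :=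
    IsLocalRing.le_maximalIdeal (Ideal.IsPrime.ne_top inferInstance)
  have htm : t ∈ maximalIdeal (X'.presheaf.stalk z) := by
    letI := χ.toAlgebra
    haveI : IsLocalization.AtPrime (X'.presheaf.stalk z) 𝔴.asIdeal := hloc
    rw [ht]
    exact (IsLocalization.AtPrime.to_map_mem_maximal_iff (X'.presheaf.stalk z) 𝔴.asIdeal _).mpr he
  have ham : a ∈ maximalIdeal (X.presheaf.stalk (π z)) := by
    by_contra hau
    have hua : IsUnit ((π.stalkMap z).hom a) := ((IsLocalRing.notMem_maximalIdeal.mp hau)).map _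
    have : t - (π.stalkMap z).hom a ∉ maximalIdeal (X'.presheaf.stalk z) := by
      intro hmem'
      have : (π.stalkMap z).hom a ∈ maximalIdeal (X'.presheaf.stalk z) := by
        have := Ideal.sub_mem _ htm hmem'
        rwa [sub_sub_cancel] at this
      exact (IsLocalRing.notMem_maximalIdeal.mpr hua) this
    exact this (hPle htP)
  have hφa : (π.stalkMap z).hom a ∈ Ideal.span ({(π.stalkMap z).hom (c₂ j)} ∪
      Set.range fun k => (π.stalkMap z).hom (w k)) := by
    have ha' : (π.stalkMap z).hom a ∈ (maximalIdeal (X.presheaf.stalk (π z))).map (π.stalkMap z).hom :=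
      Ideal.mem_map_of_mem _ ham
    rw [← hzspan, Ideal.map_span] at ha'
    refine (Ideal.span_le.mpr ?_) ha'
    rintro _ ⟨_, ⟨i, rfl⟩, rfl⟩
    induction i using Fin.addCases with
    | left i =>
      rw [Fin.append_left]
      by_cases hij : i = j
      · rw [hij]
        exact Ideal.subset_span (Or.inl rfl)
      · have hil : i = l := by
          have h1 : i.val ≠ j.val := fun h => hij (Fin.ext h)
          have h2 : l.val ≠ j.val := fun h => hl (Fin.ext h)
          apply Fin.ext
          omega
        rw [hil, hmul]
        exact Ideal.mul_mem_right _ _ (Ideal.subset_span (Or.inl rfl))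
    | right k =>
      rw [Fin.append_right]
      exact Ideal.subset_span (Or.inr ⟨k, rfl⟩)
  have hwm : ∀ k, w k ∈ maximalIdeal (X.presheaf.stalk (π z)) := fun k => by
    rw [← hzz, hw]
    exact Ideal.subset_span ⟨Fin.natAdd 2 k, rfl⟩
  have hM : Ideal.span (Set.range ![(π.stalkMap z).hom (c₂ j), t - (π.stalkMap z).hom a] ∪
      Set.range fun k => (π.stalkMap z).hom (w k)) = maximalIdeal (X'.presheaf.stalk z) := by
    apply le_antisymm
    · rw [Ideal.span_le]
      rintro r (⟨i, rfl⟩ | ⟨k, rfl⟩)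
      · fin_cases i
        · exact map_nonunit (π.stalkMap z).hom _ (hcm₂ j)
        · exact hPle htP
      · exact map_nonunit (π.stalkMap z).hom _ (hwm k)
    · -- `𝔪′ = (π♯c₂_j, t, π♯w) ⊆ (π♯c₂_j, t − π♯a, π♯w)`
      have hsub : Ideal.span ({(π.stalkMap z).hom (c₂ j)} ∪ Set.range fun k => (π.stalkMap z).hom (w k)) ≤
          Ideal.span (Set.range ![(π.stalkMap z).hom (c₂ j), t - (π.stalkMap z).hom a] ∪
            Set.range fun k => (π.stalkMap z).hom (w k)) := by
        apply Ideal.span_mono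
        rintro r (hr | hr)
        · exact Or.inl ⟨0, by rw [Set.mem_singleton_iff.mp hr]; rfl⟩
        · exact Or.inr hr
      have ht_mem : t ∈ Ideal.span (Set.range ![(π.stalkMap z).hom (c₂ j), t - (π.stalkMap z).hom a] ∪
          Set.range fun k => (π.stalkMap z).hom (w k)) := by
        have h1 : t - (π.stalkMap z).hom a ∈ Ideal.span (Set.range ![(π.stalkMap z).hom (c₂ j),
            t - (π.stalkMap z).hom a] ∪ Set.range fun k => (π.stalkMap z).hom (w k)) :=
          Ideal.subset_span (Or.inl ⟨1, rfl⟩)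
        have h2 := Ideal.add_mem _ h1 (hsub hφa)
        rwa [sub_add_cancel] at h2
      rw [← hspan', Ideal.span_le]
      rintro _ ⟨i, rfl⟩
      rw [SetLike.mem_coe]
      refine Fin.cases ?_ (fun i' => ?_) i
      · rw [chartFamily, Fin.cons_zero, RingHom.algebraMap_toAlgebra, hχ]
        exact Ideal.subset_span (Or.inl ⟨0, rfl⟩)
      · rw [chartFamily, Fin.cons_succ]
        induction i' using Fin.addCases with
        | left k =>
          rw [Fin.append_left, RingHom.algebraMap_toAlgebra, ← ht]
          exact ht_mem
        | right k =>
          rw [Fin.append_right, RingHom.algebraMap_toAlgebra, hχ]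
          exact Ideal.subset_span (Or.inr ⟨k, rfl⟩)
  have hcjP : (π.stalkMap z).hom (c₂ j) ∈ primeOfSpecializes hz := by
    refine (hφP _).mpr ?_
    rw [← hP𝔭, ← hcY₂]
    exact Ideal.subset_span ⟨j, rfl⟩
  refine ⟨![(π.stalkMap z).hom (c₂ j), t - (π.stalkMap z).hom a],
    ⟨inferInstance, e, fun k => (π.stalkMap z).hom (w k), ?_, hM⟩, ?_, ?_, ?_, ?_⟩
  · -- `dim 𝒪_{X′,z} = 2 + e`
    have h := IsRegularLocalRing.spanFinrank_maximalIdeal (R := X'.presheaf.stalk z)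
    rw [hdim'] at h
    exact_mod_cast h.symm
  · rw [Ideal.span_le]
    rintro _ ⟨i, rfl⟩
    fin_cases i
    · exact hcjP
    · exact htP
  · -- `𝓘_{Y,x} 𝒪_{X′,z} ⊆ 𝔭_{η′}` (`Γ′` maps to `Y`)
    rw [hP𝔭, Ideal.map_le_iff_le_comap, comap_stalkMap_primeOfSpecializes π hz]
  · -- UNRAMIFIED: `𝔪_z ⊆ 𝔭_{η′} + 𝔪_x 𝒪_{X′,z}`
    rw [← hM, Ideal.span_le]
    rintro r (⟨i, rfl⟩ | ⟨k, rfl⟩)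
    · fin_cases i
      · exact Ideal.mem_sup_left hcjP
      · exact Ideal.mem_sup_left htP
    · exact Ideal.mem_sup_right (Ideal.mem_map_of_mem _ (hwm k))
  · -- `(π♯c₂_j) = 𝓘_{Y,x} 𝒪_{X′,z}`
    have h0 : (![(π.stalkMap z).hom (c₂ j), t - (π.stalkMap z).hom a] : Fin 2 → X'.presheaf.stalk z) 0 =
        (π.stalkMap z).hom (c₂ j) := rfl
    rw [h0, hCmap, hχ]

end Summit.ResolutionOfSingularities.ResolutionOfSingularities.Theorems.RadicialJung.CleanModels

end
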